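import Summits.CriticalPhenomena.PercolationContinuityZ3.Theorems.PercNearOneGluingNoHeavyLowerTailAPLProfileAll
import Summits.CriticalPhenomena.PercolationContinuityZ3.Theorems.PercNearOneGluingNoHeavyLowerTailOneCutFiveThreePortApl
import Literature.Probability.Percolation.KozmaNitzanHittable
import HarnessLib

/-!
# `NoHeavyLowerTail` (stmt-CriticalPhenomena-4575) — `Z(3,2)` at EVERY three-port observer of EVERY finite weighted graph (the APL₁ hypotheses of gen 11's `ThreePort.pocketExchange_of_apl` discharged by `APL.apl23_all`)

Support file (prover prim-ineq-gen-8 gen 37; `--supports stmt-CriticalPhenomena-4575`; memo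
run/shared/lean/prim/prim-ineq-gen-8/FINDING-gen37-APL-PROOF.md).  No definitions, no named facts, no sorries.

* `apl_three_tenths_all` — APL₁(3/10) on EVERY finite weighted graph (from `APL.apl1_twoThirds_all`, constant 2/3 ≥ 3/10);
* **`threePort_pocketExchange_all`** — the conclusion of `Z(3,2)` (pocket exchange `μ(o↔a, o↮b, o↮c) ≤ μ(o↮a, o↔b, o↔c)` at the
  weakest target) at every three-port observer `o` of every finite weighted graph on `Fin n`, ALL `n` (prim-cert-1 g16: `n ≤ 63`;
  gen 13: `n ≤ 6`): `ThreePort.pocketExchange_of_apl` (gen 11) with its three APL₁(3/10) hypotheses now theorems.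
[this work]
-/

noncomputable section

namespace Summit.CriticalPhenomena.PercolationContinuityZ3.Theorems

namespace APL

open MeasureTheory Literature.Probability.Percolation Literature.Probability.LatticeModels
open scoped Classical

/-- **APL₁(3/10) on every finite weighted graph** (from APL₁(2/3), `apl1_twoThirds_all`). [this work] -/
theorem apl_three_tenths_all {V : Type*} [Fintype V] (w : Sym2 V → unitInterval) (a b c : V) :
    (3 / 10 : ℝ) * (prodBernoulli w).real ((openConn a b)ᶜ ∩ (openConn a c)ᶜ ∩ (openConn b c)ᶜ) *
        (prodBernoulli w).real (openConn a b ∩ openConn a c) ≤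
      (prodBernoulli w).real (openConn a b ∩ (openConn a c)ᶜ) + (prodBernoulli w).real (openConn a c ∩ (openConn a b)ᶜ) := by
  have h := apl1_twoThirds_all w a b c
  have h0 : 0 ≤ (prodBernoulli w).real ((openConn a b)ᶜ ∩ (openConn a c)ᶜ ∩ (openConn b c)ᶜ : Set (BondConfig V)) *
      (prodBernoulli w).real (openConn a b ∩ openConn a c : Set (BondConfig V)) :=
    mul_nonneg measureReal_nonneg measureReal_nonneg
  nlinarith

/-- **`Z(3,2)` at every three-port observer of every finite weighted graph.**  `μ = prodBernoulli w` on `Fin n` (any `n`); `o` a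
three-port observer onto distinct `a, b, c ≠ o` (every other pair at `o` has weight `0`); `Σ_v μ(o↔v) ≥ 2`; `a` the weakest target.
Then `μ(o↔a, o↮b, o↮c) ≤ μ(o↮a, o↔b, o↔c)`.  (`ThreePort.pocketExchange_of_apl` with its APL₁(3/10) hypotheses for the law off the
observer discharged by `apl_three_tenths_all`; verbatim the assembly of prim-cert-1's `threePort_pocketExchange_of_card_le`.) [this work] -/
theorem threePort_pocketExchange_all {n : ℕ} (w : Sym2 (Fin n) → unitInterval) (o a b c : Fin n)
    (hao : a ≠ o) (hbo : b ≠ o) (hco : c ≠ o) (hab : a ≠ b) (hac : a ≠ c) (hbc : b ≠ c)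
    (hobs : ∀ u, u ≠ o → u ≠ a → u ≠ b → u ≠ c → w s(o, u) = 0)
    (hsum : 2 ≤ (prodBernoulli w).real (openConn o a) + (prodBernoulli w).real (openConn o b) +
      (prodBernoulli w).real (openConn o c))
    (hqab : (prodBernoulli w).real (openConn o a) ≤ (prodBernoulli w).real (openConn o b))
    (hqac : (prodBernoulli w).real (openConn o a) ≤ (prodBernoulli w).real (openConn o c)) :
    (prodBernoulli w).real {ω | ω ∈ openConn o a ∧ ω ∉ openConn o b ∧ ω ∉ openConn o c} ≤
      (prodBernoulli w).real {ω | ω ∉ openConn o a ∧ ω ∈ openConn o b ∧ ω ∈ openConn o c} := by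
  set w' : Sym2 (Fin n) → unitInterval := fun e => if o ∈ e then (0 : unitInterval) else w e with hw'
  have hA := apl_three_tenths_all w' a b c
  have hB := apl_three_tenths_all w' b a c
  have hC := apl_three_tenths_all w' c a b
  have eba : (openConn b a : Set (BondConfig (Fin n))) = openConn a b := openConn_comm b a
  have eca : (openConn c a : Set (BondConfig (Fin n))) = openConn a c := openConn_comm c a
  have ecb : (openConn c b : Set (BondConfig (Fin n))) = openConn b c := openConn_comm c b
  rw [eba] at hB
  rw [eca, ecb] at hC
  have hu0b : ((openConn a b)ᶜ ∩ (openConn b c)ᶜ ∩ (openConn a c)ᶜ : Set (BondConfig (Fin n))) =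
      (openConn a b)ᶜ ∩ (openConn a c)ᶜ ∩ (openConn b c)ᶜ := by
    ext ω; simp only [Set.mem_inter_iff, Set.mem_compl_iff]; tauto
  have hu0c : ((openConn a c)ᶜ ∩ (openConn b c)ᶜ ∩ (openConn a b)ᶜ : Set (BondConfig (Fin n))) =
      (openConn a b)ᶜ ∩ (openConn a c)ᶜ ∩ (openConn b c)ᶜ := by
    ext ω; simp only [Set.mem_inter_iff, Set.mem_compl_iff]; tauto
  have hu3b : (openConn a b ∩ openConn b c : Set (BondConfig (Fin n))) = openConn a b ∩ openConn a c := by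
    ext ω
    simp only [Set.mem_inter_iff]
    constructor
    · rintro ⟨h1, h2⟩
      exact ⟨h1, (show (openGraph ω).Reachable a b from h1).trans h2⟩
    · rintro ⟨h1, h2⟩
      exact ⟨h1, (SimpleGraph.Reachable.symm (show (openGraph ω).Reachable a b from h1)).trans h2⟩
  have hu3c : (openConn a c ∩ openConn b c : Set (BondConfig (Fin n))) = openConn a b ∩ openConn a c := by
    ext ω
    simp only [Set.mem_inter_iff]
    constructor
    · rintro ⟨h1, h2⟩
      exact ⟨(show (openGraph ω).Reachable a c from h1).trans (SimpleGraph.Reachable.symm h2), h1⟩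
    · rintro ⟨h1, h2⟩
      exact ⟨h2, (SimpleGraph.Reachable.symm (show (openGraph ω).Reachable a b from h1)).trans h2⟩
  rw [hu0b, hu3b] at hB
  rw [hu0c, hu3c] at hC
  exact ThreePort.pocketExchange_of_apl w o a b c hao hbo hco hab hac hbc hobs hsum hqab hqac hA hB hC

end APL

end Summit.CriticalPhenomena.PercolationContinuityZ3.Theorems

end
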